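import Literature.NumberTheory.EllipticCurves.IwasawaAlgebraEisensteinQuotientDuality
import Literature.NumberTheory.EllipticCurves.IwasawaTwistModPDual
import HarnessLib

/-!
# The `λ`-contracted coefficient pairing `(𝒪 ⊗ M₁) × (𝒪 ⊗ M₂) → P` and the Tate dual of Howard's
# Eisenstein-twisted modules: `(M ⊗ A_{m,k}(ψ))^∨(1)` receives `M' ⊗ A_{m,k}(ψ⁻¹)` equivariantly

Topic `NumberTheory/EllipticCurves` (sequel to `ZpExtensionScalarTwist`, `IwasawaAlgebraEisensteinQuotientDuality`,
`IwasawaTwistModPDual`; definitions with bodies + theorems; no named fact, no instance, no notation, no `sorry`).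

Howard 2004, hypothesis H.4 of §1.3 [arXiv:1202.6340 p0007:L72–90] asks for a perfect symmetric `R`-bilinear
pairing `T × T → R(1)` with `(s^σ, t^{τστ⁻¹}) = (s, t)^σ`; for the specialised modules of §2.2
(`T_𝔮 = T_p E ⊗ S_𝔮(ψ)`) it is `e_𝔮(t₁ ⊗ α₁, t₂ ⊗ α₂) = e_Weil(t₁, t₂^τ) α₁ α₂` (Lemma 2.1.1 = arXiv
Lemma 3.1.1), and `R`-valued pairings are identified with `μ_{p^∞}`-valued ones through the functional of
§2.1 («`Hom_{S_𝔭}(N, 𝒟_𝔭(1)) ≅ Hom_{ℤ_p}(N, μ_{p^∞})`»). At the finite levels `R_k = A_{m,k} = Λ/(T^m + p, p^k)`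
of the cell's D1 tower (`ZpExtension.eisensteinTwist`, carrier `EisensteinCoeff.Twisted p m k M = A_{m,k} ⊗_ℤ M`)
this file supplies the MODULE-LEVEL part of that duality, in the tree's `tateDual` currency:

* §1 `ZMod.nsmulHom hP : ZMod n →+ (P →+ P)` — `ℤ/n` acting on an `n`-torsion group through
  representatives (`x ↦ x.val • ·`), `ZMod.val_add_nsmul_of_nsmul_eq_zero`.
* §2 (any commutative ring `𝒪`, any additive `λ : 𝒪 → ℤ/n`, any bi-additive `e : M₁ × M₂ → P` with
  `n P = 0`) **`coeffPairing λ e hP : (𝒪 ⊗ M₁) × (𝒪 ⊗ M₂) → P`**, `(c₁ ⊗ a₁, c₂ ⊗ a₂) ↦ λ(c₁c₂) · e(a₁, a₂)`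
  (`TensorProduct.map₂` of the multiplication of `𝒪` and of `e`, contracted along `λ`): `coeffPairing_tmul_tmul`,
  `𝒪`-balanced (`coeffPairing_smul_left : B(c x, y) = B(x, c y)`).
* §3 (`𝒪 = A_{m,k}`) **equivariance for a pair of twists with opposite exponents**
  (`coeffPairing_eisensteinTwist`): if `p^J ∣ e_J^{κ₁}(g) + e_J^{κ₂}(g)` at `J = eisensteinLevel` (the tree's
  `prime_pow_dvd_twistExponent_add_invTwist` for `(κ, κ⁻¹)`, `κ⁻¹ = κ.invTwist = κ.unitTwist (-1)`) and `e` is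
  `Γ_K`-equivariant, then `B(g x, g y) = g B(x, y)` for the actions `κ₁.eisensteinTwist ρ₁`, `κ₂.eisensteinTwist ρ₂`
  — «the dual of `M ⊗ A(ψ)` is `M' ⊗ A(ψ⁻¹)`»; packaged as a continuous pairing
  (`eisensteinTwistPairing`) and, for `P = μ_n`, as the **equivariant dual map**
  **`eisensteinTwistDualMap : (A_{m,k} ⊗ M₂)(ψ_{κ₂}) →ⁱ ((A_{m,k} ⊗ M₁)(ψ_{κ₁}))^∨(1) = tateDual`**
  (tree `pairingDualIntertwining`; so the tree's cup product / `cupProduct_pairing_eq_tateDualPairing` /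
  Poitou–Tate local terms apply to `B`), in particular for `(κ, κ.invTwist)` and `(κ.invTwist, κ)`
  (`eisensteinTwistDualMap_inv`, `…_inv'`). `A_{m,k}`-linearity of the dual map: `coeffPairing_smul_left`.

Perfectness (bijectivity of the dual map for `λ = EisensteinCoeff.tailFormZMod`, the tree's perfect tail form,
and `e` perfect, e.g. the Weil pairing `E[p^k] × E[p^k] → μ_{p^k}`) is the sequel. BSD is not proved by any of
this; nothing about Selmer groups is asserted.

References: [Howard2004HeegnerKolyvagin] B. Howard, Compositio Math. 140 (2004), §1.3 (H.4), §2.1 (Lemma 2.1.1 and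
the map `𝒟_𝔭 → ℚ_p/ℤ_p`), §2.2 (`T_𝔮`, proof of Thm. 2.2.10 at `𝔮 = T^m + p`); [MazurRubin2004] §1.3, §5.3 (the dual
twist carries `χ⁻¹`); [MilneADT2006] I §0, §2 (`Hom(M, μ_n)` with `(σf)(m) = σ f(σ⁻¹ m)`).
-/

noncomputable section

open scoped TensorProduct ContRepresentation
open Field

universe u v w w₁ w₂ w₃

namespace Literature.NumberTheory.EllipticCurves

open Literature.NumberTheory.GaloisRepresentations

/-! ## §1 `ℤ/n` acting on an `n`-torsion abelian group through representatives -/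

section ZModAct

variable {n : ℕ} [NeZero n] {P : Type w} [AddCommGroup P]

omit [NeZero n] in
/-- On a group killed by `n`, `a • q` depends only on `a mod n`. [cite: Washington1997, §13.2] -/
theorem nsmul_mod_eq_nsmul_of_nsmul_eq_zero (hP : ∀ q : P, n • q = 0) (a : ℕ) (q : P) :
    (a % n) • q = a • q := by
  conv_rhs => rw [← Nat.mod_add_div a n, add_smul, mul_smul, hP, add_zero]

/-- `(x + y).val • q = x.val • q + y.val • q` on a group killed by `n`. [cite: Washington1997, §13.2] -/
theorem ZMod.val_add_nsmul_of_nsmul_eq_zero (hP : ∀ q : P, n • q = 0) (x y : ZMod n) (q : P) :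
    (x + y).val • q = x.val • q + y.val • q := by
  rw [ZMod.val_add, nsmul_mod_eq_nsmul_of_nsmul_eq_zero hP, add_smul]

/-- **`ℤ/n → End(P)`, `x ↦ (q ↦ x.val • q)`** for an abelian group `P` killed by `n`: the `ℤ/n`-module
structure of `P` as an additive homomorphism (no instance is declared). [cite: Washington1997, §13.2] -/
def ZMod.nsmulHom (hP : ∀ q : P, n • q = 0) : ZMod n →+ (P →+ P) where
  toFun x := AddMonoidHom.mk' (fun q => x.val • q) fun a b => smul_add _ _ _
  map_zero' := AddMonoidHom.ext fun q => by
    rw [AddMonoidHom.mk'_apply, ZMod.val_zero, zero_smul, AddMonoidHom.zero_apply]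
  map_add' x y := AddMonoidHom.ext fun q => by
    rw [AddMonoidHom.mk'_apply, AddMonoidHom.add_apply, AddMonoidHom.mk'_apply, AddMonoidHom.mk'_apply]
    exact ZMod.val_add_nsmul_of_nsmul_eq_zero hP x y q

/-- Unfolding: `ZMod.nsmulHom hP x q = x.val • q`. [cite: Washington1997, §13.2] -/
@[simp]
theorem ZMod.nsmulHom_apply_apply (hP : ∀ q : P, n • q = 0) (x : ZMod n) (q : P) :
    ZMod.nsmulHom hP x q = x.val • q := rfl

/-- `1 ∈ ℤ/n` acts as the identity (`n > 1`; for `n = 1` both sides are `0 = q` in the zero group). [cite: Washington1997, §13.2] -/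
theorem ZMod.nsmulHom_one_apply (hP : ∀ q : P, n • q = 0) (q : P) : ZMod.nsmulHom hP 1 q = q := by
  rw [ZMod.nsmulHom_apply_apply, ZMod.val_one_eq_one_mod, nsmul_mod_eq_nsmul_of_nsmul_eq_zero hP, one_smul]

end ZModAct

/-! ## §2 The `λ`-contracted coefficient pairing `(𝒪 ⊗ M₁) × (𝒪 ⊗ M₂) → P` -/

section CoeffPairing

variable {𝒪 : Type v} [CommRing 𝒪] {n : ℕ} [NeZero n] (lam : 𝒪 →+ ZMod n)
  {M₁ : Type w₁} {M₂ : Type w₂} {P : Type w₃} [AddCommGroup M₁] [AddCommGroup M₂] [AddCommGroup P]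
  (e : M₁ →+ M₂ →+ P) (hP : ∀ q : P, n • q = 0)

/-- A bi-additive map as a `ℤ`-bilinear map (plumbing). [cite: MilneADT2006, I §0 (pairings of G-modules)] -/
def AddMonoidHom.toIntBilin (e : M₁ →+ M₂ →+ P) : M₁ →ₗ[ℤ] M₂ →ₗ[ℤ] P :=
  LinearMap.mk₂ ℤ (fun a b => e a b) (fun a a' b => by rw [map_add, AddMonoidHom.add_apply])
    (fun z a b => by
      change e.flip b (z • a) = z • e.flip b a
      rw [map_zsmul])
    (fun a b b' => map_add _ _ _) (fun z a b => map_zsmul _ _ _)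

/-- Unfolding `toIntBilin`. [cite: MilneADT2006, I §0] -/
@[simp]
theorem AddMonoidHom.toIntBilin_apply_apply (e : M₁ →+ M₂ →+ P) (a : M₁) (b : M₂) :
    AddMonoidHom.toIntBilin e a b = e a b := rfl

/-- `c ↦ (q ↦ λ(c) · q)`: the coefficient ring acting on the `n`-torsion group `P` through `λ : 𝒪 → ℤ/n`.
[cite: Howard2004HeegnerKolyvagin, §2.1 (Hom_{S_𝔭}(N, 𝒟_𝔭(1)) ≅ Hom_{ℤ_p}(N, μ_{p^∞}))] -/
def lamAct : 𝒪 →+ (P →+ P) := (ZMod.nsmulHom hP).comp lam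

/-- Unfolding: `lamAct λ hP c q = (λ c).val • q`. [cite: Howard2004HeegnerKolyvagin, §2.1] -/
@[simp]
theorem lamAct_apply_apply (c : 𝒪) (q : P) : lamAct lam hP c q = (lam c).val • q := rfl

/-- The contraction `𝒪 ⊗_ℤ P → P`, `c ⊗ q ↦ λ(c) · q`. [cite: Howard2004HeegnerKolyvagin, §2.1] -/
def coeffContract : 𝒪 ⊗[ℤ] P →ₗ[ℤ] P :=
  TensorProduct.lift (LinearMap.mk₂ ℤ (fun c q => lamAct lam hP c q)
    (fun c c' q => by rw [map_add, AddMonoidHom.add_apply])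
    (fun z c q => by
      change (AddMonoidHom.eval q).comp (lamAct lam hP) (z • c) = z • (AddMonoidHom.eval q).comp (lamAct lam hP) c
      rw [map_zsmul])
    (fun c q q' => map_add _ _ _) (fun z c q => by rw [lamAct_apply_apply, lamAct_apply_apply, smul_comm]))

/-- Unfolding: `coeffContract (c ⊗ q) = (λ c).val • q`. [cite: Howard2004HeegnerKolyvagin, §2.1] -/
@[simp]
theorem coeffContract_tmul (c : 𝒪) (q : P) : coeffContract lam hP (c ⊗ₜ[ℤ] q) = (lam c).val • q :=
  TensorProduct.lift.tmul _ _

/-- The pairing as a `ℤ`-bilinear map on Mathlib's tensor products: `TensorProduct.map₂` of the multiplication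
`𝒪 × 𝒪 → 𝒪` and of `e`, followed by the contraction along `λ`. [cite: Howard2004HeegnerKolyvagin, §2.1 and Lemma 2.1.1] -/
def coeffPairingLin : 𝒪 ⊗[ℤ] M₁ →ₗ[ℤ] 𝒪 ⊗[ℤ] M₂ →ₗ[ℤ] P :=
  (TensorProduct.map₂ (LinearMap.mul ℤ 𝒪) (AddMonoidHom.toIntBilin e)).compr₂ (coeffContract lam hP)

/-- Unfolding on pure tensors: `coeffPairingLin (c₁ ⊗ a₁) (c₂ ⊗ a₂) = (λ (c₁ c₂)).val • e a₁ a₂`.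
[cite: Howard2004HeegnerKolyvagin, Lemma 2.1.1 (e_𝔭(t₁ ⊗ α₁, t₂ ⊗ α₂) = e(t₁, t₂^τ) ⊗ α₁α₂)] -/
@[simp]
theorem coeffPairingLin_tmul_tmul (c₁ c₂ : 𝒪) (a₁ : M₁) (a₂ : M₂) :
    coeffPairingLin lam e hP (c₁ ⊗ₜ[ℤ] a₁) (c₂ ⊗ₜ[ℤ] a₂) = (lam (c₁ * c₂)).val • e a₁ a₂ := by
  rw [coeffPairingLin, LinearMap.compr₂_apply, TensorProduct.map₂_apply_tmul, TensorProduct.map_tmul,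
    coeffContract_tmul]
  rfl

/-- **The `λ`-contracted coefficient pairing** `B = B_{λ,e} : (𝒪 ⊗ M₁) × (𝒪 ⊗ M₂) → P`,
`B(c₁ ⊗ a₁, c₂ ⊗ a₂) = λ(c₁ c₂) · e(a₁, a₂)`, on the tree's carriers `CoeffExtension ℤ 𝒪 Mᵢ = 𝒪 ⊗_ℤ Mᵢ`
(bi-additive). For `𝒪 = S_𝔮 ↠ A_{m,k}`, `λ` the tail form and `e` the (τ-twisted) Weil pairing this is
Howard's `e_𝔮` read through `Hom_{S_𝔮}(·, S_𝔮(1)) ≅ Hom(·, μ)`. [cite: Howard2004HeegnerKolyvagin, §2.1 and Lemma 2.1.1] -/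
def coeffPairing : CoeffExtension ℤ 𝒪 M₁ →+ CoeffExtension ℤ 𝒪 M₂ →+ P :=
  (LinearMap.toAddMonoidHom' : (𝒪 ⊗[ℤ] M₂ →ₗ[ℤ] P) →+ (𝒪 ⊗[ℤ] M₂ →+ P)).comp
    (coeffPairingLin lam e hP).toAddMonoidHom

/-- **Unfolding on pure tensors**: `B(c₁ ⊗ a₁, c₂ ⊗ a₂) = (λ (c₁ c₂)).val • e a₁ a₂`.
[cite: Howard2004HeegnerKolyvagin, Lemma 2.1.1] -/
@[simp]
theorem coeffPairing_tmul_tmul (c₁ c₂ : 𝒪) (a₁ : M₁) (a₂ : M₂) :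
    coeffPairing lam e hP (CoeffExtension.tmul c₁ a₁) (CoeffExtension.tmul c₂ a₂) = (lam (c₁ * c₂)).val • e a₁ a₂ :=
  coeffPairingLin_tmul_tmul lam e hP c₁ c₂ a₁ a₂

/-- **`B` is `𝒪`-balanced**: `B(c • x, y) = B(x, c • y)` — the dual map `y ↦ B(·, y)` is `𝒪`-linear for the
`𝒪`-structure `(c f)(x) = f(c x)` on `Hom(𝒪 ⊗ M₁, P)`. [cite: Howard2004HeegnerKolyvagin, §2.1 («isomorphism of S_𝔭-modules»)] -/
theorem coeffPairing_smul_left (c : 𝒪) (x : CoeffExtension ℤ 𝒪 M₁) (y : CoeffExtension ℤ 𝒪 M₂) :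
    coeffPairing lam e hP (c • x) y = coeffPairing lam e hP x (c • y) := by
  induction x using CoeffExtension.induction_on with
  | zero => rw [smul_zero, map_zero, AddMonoidHom.zero_apply, AddMonoidHom.zero_apply]
  | tmul c₁ a₁ =>
    induction y using CoeffExtension.induction_on with
    | zero => rw [smul_zero, map_zero, map_zero]
    | tmul c₂ a₂ =>
      rw [show c • (CoeffExtension.tmul c₁ a₁ : CoeffExtension ℤ 𝒪 M₁) = CoeffExtension.tmul (c * c₁) a₁ from
          TensorProduct.smul_tmul' c c₁ a₁,
        show c • (CoeffExtension.tmul c₂ a₂ : CoeffExtension ℤ 𝒪 M₂) = CoeffExtension.tmul (c * c₂) a₂ from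
          TensorProduct.smul_tmul' c c₂ a₂,
        coeffPairing_tmul_tmul, coeffPairing_tmul_tmul, mul_assoc, mul_left_comm]
    | add y y' hy hy' => rw [smul_add, map_add, map_add, hy, hy']
  | add x x' hx hx' =>
    rw [smul_add, map_add, map_add, AddMonoidHom.add_apply, AddMonoidHom.add_apply, hx, hx']

/-- Symmetry transfer: if `e'(b, a) = e(a, b)` then `B_{λ,e'}(y, x) = B_{λ,e}(x, y)` (commutativity of `𝒪`).
[cite: Howard2004HeegnerKolyvagin, §1.3 (H.4, «symmetric»)] -/
theorem coeffPairing_flip (e' : M₂ →+ M₁ →+ P) (he' : ∀ a b, e' b a = e a b) (x : CoeffExtension ℤ 𝒪 M₁)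
    (y : CoeffExtension ℤ 𝒪 M₂) : coeffPairing lam e' hP y x = coeffPairing lam e hP x y := by
  induction x using CoeffExtension.induction_on with
  | zero => rw [map_zero, map_zero, AddMonoidHom.zero_apply]
  | tmul c₁ a₁ =>
    induction y using CoeffExtension.induction_on with
    | zero => rw [map_zero, AddMonoidHom.zero_apply, map_zero]
    | tmul c₂ a₂ => rw [coeffPairing_tmul_tmul, coeffPairing_tmul_tmul, he', mul_comm]
    | add y y' hy hy' => rw [map_add, AddMonoidHom.add_apply, map_add, hy, hy']
  | add x x' hx hx' => rw [map_add, map_add, AddMonoidHom.add_apply, hx, hx']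

end CoeffPairing

/-! ## §3 Equivariance for Howard's Eisenstein twists and the dual map into `tateDual` -/

namespace ZpExtension

variable {K : Type u} [Field K] {p : ℕ} [hp : Fact p.Prime] {m : ℕ} (hm : 1 ≤ m) (k : ℕ)
  {n : ℕ} [NeZero n] (lam : IwasawaAlgebra.EisensteinCoeff p m k →+ ZMod n)
  {M₁ M₂ P : Type u} [AddCommGroup M₁] [TopologicalSpace M₁] [DiscreteTopology M₁]
  [AddCommGroup M₂] [TopologicalSpace M₂] [DiscreteTopology M₂]
  [AddCommGroup P] [TopologicalSpace P] [DiscreteTopology P]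
  (ρ₁ : DiscreteGaloisModule K M₁) (ρ₂ : DiscreteGaloisModule K M₂) (ρP : DiscreteGaloisModule K P)
  (e : M₁ →+ M₂ →+ P) (hP : ∀ q : P, n • q = 0)
  (he : ∀ (g : absoluteGaloisGroup K) (a : M₁) (b : M₂), e (ρ₁ g a) (ρ₂ g b) = ρP g (e a b))
  (κ₁ κ₂ : ZpExtension K p)
  (hκ : ∀ g : absoluteGaloisGroup K,
    p ^ eisensteinLevel (p := p) hm k ∣ κ₁.twistExponent (eisensteinLevel (p := p) hm k) g +
      κ₂.twistExponent (eisensteinLevel (p := p) hm k) g)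

/-- Opposite exponents cancel: `(1+T)^{e₁(g)} (1+T)^{e₂(g)} = 1` in `A_{m,k}` when `p^J ∣ e₁(g) + e₂(g)`,
`J = eisensteinLevel` (`(1+T)^{p^J} = 1`). [cite: Washington1997, §13.2] [cite: Howard2004HeegnerKolyvagin, §2.2] -/
theorem onePlusT_pow_mul_onePlusT_pow_eq_one {a b : ℕ} (hab : p ^ eisensteinLevel (p := p) hm k ∣ a + b) :
    IwasawaAlgebra.EisensteinCoeff.onePlusT p m k ^ a * IwasawaAlgebra.EisensteinCoeff.onePlusT p m k ^ b = 1 := by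
  obtain ⟨t, ht⟩ := hab
  rw [← pow_add, ht, pow_mul, onePlusT_pow_prime_pow_eisensteinLevel (p := p) hm k, one_pow]

omit [TopologicalSpace M₁] [DiscreteTopology M₁] [TopologicalSpace M₂] [DiscreteTopology M₂] [TopologicalSpace P]
  [DiscreteTopology P] in
/-- `coeffPairing` on the pinned pure tensors of `A_{m,k} ⊗ M`: `B(c₁ ⊗ a₁, c₂ ⊗ a₂) = (λ (c₁c₂)).val • e a₁ a₂`.
[cite: Howard2004HeegnerKolyvagin, Lemma 2.1.1] -/
theorem coeffPairing_twisted_tmul_tmul (c₁ c₂ : IwasawaAlgebra.EisensteinCoeff p m k) (a₁ : M₁) (a₂ : M₂) :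
    coeffPairing lam e hP (IwasawaAlgebra.EisensteinCoeff.Twisted.tmul c₁ a₁)
      (IwasawaAlgebra.EisensteinCoeff.Twisted.tmul c₂ a₂) = (lam (c₁ * c₂)).val • e a₁ a₂ :=
  coeffPairing_tmul_tmul lam e hP c₁ c₂ a₁ a₂

include he hκ in
/-- **Equivariance of the coefficient pairing for a pair of Eisenstein twists with opposite exponents**:
`B(g·x, g·y) = g·B(x, y)` for `g` acting on `A_{m,k} ⊗ M₁` by `κ₁.eisensteinTwist ρ₁` and on `A_{m,k} ⊗ M₂` by
`κ₂.eisensteinTwist ρ₂`, provided `p^J ∣ e_J^{κ₁}(g) + e_J^{κ₂}(g)` (e.g. `κ₂ = κ₁⁻¹`) and `e` is equivariant —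
the dual twist carries `ψ⁻¹`. Holds for ANY additive `λ`. [cite: Howard2004HeegnerKolyvagin, §1.3 (H.4: (s^σ, t^{τστ⁻¹}) = (s,t)^σ) and Lemma 2.1.1]
[cite: MazurRubin2004, §5.3] -/
theorem coeffPairing_eisensteinTwist (g : absoluteGaloisGroup K)
    (x : IwasawaAlgebra.EisensteinCoeff.Twisted p m k M₁) (y : IwasawaAlgebra.EisensteinCoeff.Twisted p m k M₂) :
    coeffPairing lam e hP (κ₁.eisensteinTwist ρ₁ hm k g x) (κ₂.eisensteinTwist ρ₂ hm k g y) =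
      ρP g (coeffPairing lam e hP x y) := by
  induction x using IwasawaAlgebra.EisensteinCoeff.Twisted.induction_on with
  | zero => rw [map_zero, map_zero, AddMonoidHom.zero_apply, AddMonoidHom.zero_apply, map_zero]
  | tmul c₁ a₁ =>
    induction y using IwasawaAlgebra.EisensteinCoeff.Twisted.induction_on with
    | zero => rw [map_zero, map_zero, map_zero, map_zero]
    | tmul c₂ a₂ =>
      rw [eisensteinTwist_apply_tmul, eisensteinTwist_apply_tmul, coeffPairing_twisted_tmul_tmul,
        coeffPairing_twisted_tmul_tmul, he, map_nsmul,
        mul_mul_mul_comm, onePlusT_pow_mul_onePlusT_pow_eq_one hm k (hκ g), one_mul]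
    | add y y' hy hy' => rw [map_add, map_add, map_add, map_add, hy, hy']
  | add x x' hx hx' =>
    rw [map_add, map_add, AddMonoidHom.add_apply, map_add, AddMonoidHom.add_apply, map_add, hx, hx']

/-- **The coefficient pairing as a continuous `Γ_K`-equivariant pairing of the two twists**
`(A_{m,k} ⊗ M₁)(ψ_{κ₁}) × (A_{m,k} ⊗ M₂)(ψ_{κ₂}) → P` (tree `DiscreteGaloisModule.pairing`; feeds the tree's cup
product `ContPairing.cupProduct` and `cupProduct_pairing_eq_tateDualPairing`). [cite: Howard2004HeegnerKolyvagin, §1.3 (H.4) and Lemma 2.1.1] -/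
def eisensteinTwistPairing :
    ContPairing (κ₁.eisensteinTwist ρ₁ hm k).toTopRep (κ₂.eisensteinTwist ρ₂ hm k).toTopRep ρP.toTopRep :=
  DiscreteGaloisModule.pairing (κ₁.eisensteinTwist ρ₁ hm k) (κ₂.eisensteinTwist ρ₂ hm k) ρP (coeffPairing lam e hP)
    (coeffPairing_eisensteinTwist hm k lam ρ₁ ρ₂ ρP e hP he κ₁ κ₂ hκ)

/-- Unfolding `eisensteinTwistPairing`. [cite: Howard2004HeegnerKolyvagin, Lemma 2.1.1] -/
@[simp]
theorem eisensteinTwistPairing_toLin_apply (x : IwasawaAlgebra.EisensteinCoeff.Twisted p m k M₁)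
    (y : IwasawaAlgebra.EisensteinCoeff.Twisted p m k M₂) :
    (eisensteinTwistPairing hm k lam ρ₁ ρ₂ ρP e hP he κ₁ κ₂ hκ).toLin x y = coeffPairing lam e hP x y := rfl

end ZpExtension

namespace ZpExtension

variable {K : Type u} [Field K] {p : ℕ} [hp : Fact p.Prime] {m : ℕ} (hm : 1 ≤ m) (k : ℕ)
  (n : ℕ) [NeZero n] (lam : IwasawaAlgebra.EisensteinCoeff p m k →+ ZMod n)
  {M₁ M₂ : Type u} [AddCommGroup M₁] [TopologicalSpace M₁] [DiscreteTopology M₁]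
  [AddCommGroup M₂] [TopologicalSpace M₂] [DiscreteTopology M₂]
  (ρ₁ : DiscreteGaloisModule K M₁) (ρ₂ : DiscreteGaloisModule K M₂)
  (e : M₁ →+ M₂ →+ DiscreteGaloisModule.MuCarrier K n)
  (he : ∀ (g : absoluteGaloisGroup K) (a : M₁) (b : M₂),
    e (ρ₁ g a) (ρ₂ g b) = DiscreteGaloisModule.mu K n g (e a b))
  (κ₁ κ₂ : ZpExtension K p)
  (hκ : ∀ g : absoluteGaloisGroup K,
    p ^ eisensteinLevel (p := p) hm k ∣ κ₁.twistExponent (eisensteinLevel (p := p) hm k) g +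
      κ₂.twistExponent (eisensteinLevel (p := p) hm k) g)

omit [NeZero n] in
/-- `μ_n(K̄)` is killed by `n`. [cite: MilneADT2006, I §0] -/
theorem nsmul_muCarrier_eq_zero (x : DiscreteGaloisModule.MuCarrier K n) : n • x = 0 := by
  apply (DiscreteGaloisModule.MuCarrier.toAdditive (K := K)).injective
  rw [map_nsmul, map_zero]
  apply Additive.toMul.injective
  rw [toMul_nsmul, toMul_zero]
  exact Subtype.ext (by
    rw [SubmonoidClass.coe_pow, OneMemClass.coe_one]
    exact (mem_rootsOfUnity _ _).mp (DiscreteGaloisModule.MuCarrier.toAdditive x).toMul.2)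

/-- **The equivariant dual map of the Eisenstein twists**: `(A_{m,k} ⊗ M₂)(ψ_{κ₂}) →ⁱ ((A_{m,k} ⊗ M₁)(ψ_{κ₁}))^∨(1)`,
`y ↦ (x ↦ B(x, y)) ∈ Hom(A_{m,k} ⊗ M₁, μ_n)` (tree `pairingDualIntertwining`), for `μ_n`-valued equivariant `e`
and opposite exponents; `A_{m,k}`-linear by `coeffPairing_smul_left`. At `λ` = the tail form and `e` = the Weil
pairing (composed with `t ↦ t^τ`) this is the finite-level form of Howard's `T_𝔮^* ≅ Tw(T_𝔮)` (H.4 / Lemma 2.1.1).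
The instance argument `Finite (A_{m,k} ⊗ M₁)` is the tree's `EisensteinCoeff.finite_twisted` (finite `M₁`, `m ≥ 1`).
[cite: Howard2004HeegnerKolyvagin, §1.3 (H.4) and Lemma 2.1.1] [cite: MazurRubin2004, §1.3 and §5.3] -/
def eisensteinTwistDualMap [Finite (IwasawaAlgebra.EisensteinCoeff.Twisted p m k M₁)] :
    (κ₂.eisensteinTwist ρ₂ hm k).toContRepresentation →ⁱL
      ((κ₁.eisensteinTwist ρ₁ hm k).tateDual n).toContRepresentation :=
  DiscreteGaloisModule.pairingDualIntertwining (ρ₁ := κ₁.eisensteinTwist ρ₁ hm k) (ρ₂ := κ₂.eisensteinTwist ρ₂ hm k)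
    (n := n) (B := coeffPairing lam e (nsmul_muCarrier_eq_zero n))
    (coeffPairing_eisensteinTwist hm k lam ρ₁ ρ₂ (DiscreteGaloisModule.mu K n) e (nsmul_muCarrier_eq_zero n) he κ₁ κ₂ hκ)

/-- Unfolding: `eisensteinTwistDualMap y x = B(x, y)`. [cite: Howard2004HeegnerKolyvagin, Lemma 2.1.1] -/
@[simp]
theorem eisensteinTwistDualMap_apply_apply [Finite (IwasawaAlgebra.EisensteinCoeff.Twisted p m k M₁)]
    (y : IwasawaAlgebra.EisensteinCoeff.Twisted p m k M₂) (x : IwasawaAlgebra.EisensteinCoeff.Twisted p m k M₁) :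
    eisensteinTwistDualMap hm k n lam ρ₁ ρ₂ e he κ₁ κ₂ hκ y x = coeffPairing lam e (nsmul_muCarrier_eq_zero n) x y :=
  rfl

/-- The dual map is `A_{m,k}`-linear for `(c f)(x) = f(c x)`: `Θ(c y)(x) = Θ(y)(c x)`.
[cite: Howard2004HeegnerKolyvagin, §2.1 («isomorphism of S_𝔭-modules»)] -/
theorem eisensteinTwistDualMap_smul_apply [Finite (IwasawaAlgebra.EisensteinCoeff.Twisted p m k M₁)]
    (c : IwasawaAlgebra.EisensteinCoeff p m k) (y : IwasawaAlgebra.EisensteinCoeff.Twisted p m k M₂)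
    (x : IwasawaAlgebra.EisensteinCoeff.Twisted p m k M₁) :
    eisensteinTwistDualMap hm k n lam ρ₁ ρ₂ e he κ₁ κ₂ hκ (c • y) x =
      eisensteinTwistDualMap hm k n lam ρ₁ ρ₂ e he κ₁ κ₂ hκ y (c • x) := by
  rw [eisensteinTwistDualMap_apply_apply, eisensteinTwistDualMap_apply_apply, coeffPairing_smul_left]

omit [NeZero n] in
/-- The exponent hypothesis for `(κ, κ⁻¹)`: `p^J ∣ e_J^{κ}(g) + e_J^{κ⁻¹}(g)` (tree
`prime_pow_dvd_twistExponent_add_invTwist`). [cite: Washington1997, §13.1–§13.2] -/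
theorem twistExponent_add_invTwist_dvd (κ : ZpExtension K p) (g : absoluteGaloisGroup K) :
    p ^ eisensteinLevel (p := p) hm k ∣ κ.twistExponent (eisensteinLevel (p := p) hm k) g +
      κ.invTwist.twistExponent (eisensteinLevel (p := p) hm k) g :=
  κ.prime_pow_dvd_twistExponent_add_invTwist _ g

omit [NeZero n] in
/-- The exponent hypothesis for `(κ⁻¹, κ)`. [cite: Washington1997, §13.1–§13.2] -/
theorem twistExponent_invTwist_add_dvd (κ : ZpExtension K p) (g : absoluteGaloisGroup K) :
    p ^ eisensteinLevel (p := p) hm k ∣ κ.invTwist.twistExponent (eisensteinLevel (p := p) hm k) g +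
      κ.twistExponent (eisensteinLevel (p := p) hm k) g := by
  rw [add_comm]; exact κ.prime_pow_dvd_twistExponent_add_invTwist _ g

/-- **`(A_{m,k} ⊗ M₂)(ψ⁻¹) →ⁱ ((A_{m,k} ⊗ M₁)(ψ))^∨(1)`** — the dual of the `κ`-twist receives the `κ⁻¹`-twist.
[cite: Howard2004HeegnerKolyvagin, §1.3 (H.4) and Lemma 2.1.1] [cite: MazurRubin2004, §5.3] -/
def eisensteinTwistDualMap_inv [Finite (IwasawaAlgebra.EisensteinCoeff.Twisted p m k M₁)] (κ : ZpExtension K p) :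
    (κ.invTwist.eisensteinTwist ρ₂ hm k).toContRepresentation →ⁱL
      ((κ.eisensteinTwist ρ₁ hm k).tateDual n).toContRepresentation :=
  eisensteinTwistDualMap hm k n lam ρ₁ ρ₂ e he κ κ.invTwist (twistExponent_add_invTwist_dvd hm k κ)

/-- **`(A_{m,k} ⊗ M₂)(ψ) →ⁱ ((A_{m,k} ⊗ M₁)(ψ⁻¹))^∨(1)`** — the mirror statement, for the D1 convention in
which the carrier itself is the `κ.unitTwist (-1) = κ⁻¹`-twist. [cite: Howard2004HeegnerKolyvagin, §1.3 (H.4) and Lemma 2.1.1] [cite: MazurRubin2004, §5.3] -/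
def eisensteinTwistDualMap_inv' [Finite (IwasawaAlgebra.EisensteinCoeff.Twisted p m k M₁)] (κ : ZpExtension K p) :
    (κ.eisensteinTwist ρ₂ hm k).toContRepresentation →ⁱL
      ((κ.invTwist.eisensteinTwist ρ₁ hm k).tateDual n).toContRepresentation :=
  eisensteinTwistDualMap hm k n lam ρ₁ ρ₂ e he κ.invTwist κ (twistExponent_invTwist_add_dvd hm k κ)

end ZpExtension

end Literature.NumberTheory.EllipticCurves
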